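import Literature.MathematicalPhysics.QuantumFieldTheory.Balaban1983to89.T3TailTransferLower
import Literature.MathematicalPhysics.QuantumFieldTheory.Balaban1983to89.T3UnitLawDensityEML
import Literature.MathematicalPhysics.QuantumFieldTheory.Balaban1983to89.T3ReflectionCone
import Literature.MathematicalPhysics.QuantumFieldTheory.Balaban1983to89.T4WilsonLinkAffine
import HarnessLib

/-!
# `Balaban1983to89.T3NontrivialityFromTilt` — NON-TRIVIALITY OF THE d = 3 LOOP LAWS IS FREE GIVEN THE UNIT-SCALE TILT:
# `UnitTiltTail` with merely SUMMABLE radii and tails ⇒ (NT3) `UniformVariance` for every plaquette label (SU(2), printed averaging)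

Cell `ym3-torus` (HUMAN RULING D-0037, YM ladder rung R3), seat `ym3-torus-p2` gen 15 (IR-side node; purpose line «non-Gaussianity
witness»).  WHAT THIS IS NOT: not d = 4, not infinite volume, not a mass gap, not Clay, and NOT a proof of (NT3): the antecedent
`T3UnitScaleTilt.UnitTiltTail` (K1 ∧ K2 of route `UnitScaleTilt`, [King1986] Thm 3.4 (3.9)–(3.13) transported to SU(2) YM₃) is OPEN and
NOT in print.  What is proved is that (NT3) needs NO FURTHER ESTIMATE: the sibling `T3TailTransferLower.uniformVariance_polyakov_of_smallMass`
(gen 6) required the large-field masses to be SMALL (`Σ(w + w') < e^{−2Σr}/4`); here the radii `r` and the masses `w, w'` are only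
asked to be summable — exactly the hypotheses under which `UnitTiltTail` already gives existence (`hasContinuumLimit_of_unitTiltTail`).

THE ARGUMENT (all inputs are tree theorems).
* §1 GEOMETRY ON `SU(2) ≅ S³`: every affine level set `{g | κ + Re(su2Quat g · a) = t}`, `a ≠ 0`, is Haar-null — in the cone picture of
  `T4HaarSU2Translate.haar_null_iff` it is the hyperplane `(star a)ᗮ` or T4RadialProjectionAC's `degenerateCone`, both null for additive
  Haar measure (`Measure.addHaar_submodule`, `measure_degenerateCone`; stated for any Euclidean space of dimension `≥ 2`).
* §2 PRODUCT HAAR: a measurable function of the gauge field which is one-link quaternion-affine with non-zero datum through some bond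
  (`T4GnomonicWilsonHessian.LinkAffine`; every plaquette variable is, `T4WilsonLinkAffine.linkAffine_reTr_plaqHol`) has product-Haar-null
  level sets (Fubini over that one link, `MeasureTheory.lmarginal`).
* §3 THE PLAQUETTE LABEL `plaquette3 x μ ν` (`μ ≠ ν`) reads `reTr U(∂p)` at the unit lattice; by gen 2's
  `T3UnitLawDensityEML.unitLaw_eq_withDensity_emlDensity` (the unit law of EVERY approximation has a density w.r.t. product Haar on `T₁`)
  its law under every unit law has NO ATOMS.
* §4 THE CORE (bookkeeping over gen 6's multiplicative lower transfer `T3TailTransferLower.le_integral_unitLaw_mul`, every `G`, every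
  measurable `ℰ`, any atomless unit-field observable `|W| ≤ 1`): start the transfer at a LATE cut-off `K₀` (`e^{−2Σ_{k≥K₀} r} ≥ 3/4`,
  `Σ_{k≥K₀}(w + w') ≤ 1/8` — tails of summable series), let `m` be the limit of the means (King's Cauchy device
  `exists_tendsto_integral_unitLaw`), pick `δ` with `μ_{K₀}{|W − m| < δ} ≤ 1/4` (no atom at `m`), and read Chebyshev:
  `Var_K(W) ≥ (δ/2)²·μ_K{|W − m| ≥ δ} ≥ (δ/2)²·(¾·¾ − ⅛) = 7δ²/64` for all large `K`.
* §5 (NT3) `UniformVariance (F.scheme ℰp γ) (plaquette3 x μ ν) c` for SOME `c > 0`, hence `LimitPointsNontrivial`, the non-Gaussian limit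
  loop law (`limitLoopLaw_nondegenerate`) and `ContinuumYM3Torus ∧ LimitPointsNontrivial` — from `UnitTiltTail` ALONE.  (The constant `c`
  is not explicit: it depends on the unknown limit law through `δ`; gen 6's Polyakov margin `1/4` remains the quantitative statement.)

References: C. King, Commun. Math. Phys. 102 (1986) 649–677 [King1986] (Thm 3.4 (3.9)–(3.13) pp.656–657); S. Chatterjee, in
*Probability and Analysis in Interacting Physical Systems* (Springer 2019) [Chatterjee2019YMProbabilists] (§6–§7 p.19: «nontrivial
behavior» of Wilson loop variables in the continuum limit); A. Jaffe, E. Witten, *Quantum Yang–Mills theory* (Clay 2006)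
[JaffeWittenClay2006] (§4 p.6, §6.5 p.11); T. Bałaban, Commun. Math. Phys. 109 (1987) 249–301 [Balaban1987RG1] ((0.2)/(0.4) p.252–253).
-/

noncomputable section

open MeasureTheory Filter Topology Set
open scoped ENNReal Quaternion RealInnerProductSpace
open Literature.MathematicalPhysics.QuantumFieldTheory.Balaban1983to89.T3ContinuumYM3Torus
open Literature.MathematicalPhysics.QuantumFieldTheory.Balaban1983to89.T3ThresholdRemoval
open Literature.MathematicalPhysics.QuantumFieldTheory.Balaban1983to89.T3UnitScaleTilt
open Literature.MathematicalPhysics.QuantumFieldTheory.Balaban1983to89.T3UnitLawDensityEML (ℰp measurableE_ℰp)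
open Literature.MathematicalPhysics.QuantumFieldTheory.Balaban1983to89.T3TailTransferLower
open Literature.MathematicalPhysics.QuantumFieldTheory.Balaban1983to89.T4Continuum
open Literature.MathematicalPhysics.QuantumFieldTheory.Balaban1983to89.T4ReflectionCone (plaqWord)
open Literature.MathematicalPhysics.QuantumLattice (su2Quat norm_su2Quat quatToSU2 su2Quat_ne_zero)
open Literature.MathematicalPhysics.QuantumFieldTheory.Balaban1983to89.T4HaarSU2Translate (su2Quat_mul su2Quat_one
  su2Quat_quatToSU2 haar_null_iff haarData_haar_eq two_le_finrank_quaternion continuous_su2Quat)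
open Literature.MathematicalPhysics.QuantumFieldTheory.Balaban1983to89.T4CubeChartGnomonic (SU2)
open Literature.MathematicalPhysics.QuantumFieldTheory.Balaban1983to89.T4GnomonicWilsonHessian (LinkAffine reTr_eq_re_su2Quat)
open Literature.MathematicalPhysics.QuantumFieldTheory.Balaban1983to89.T4WilsonLinkAffine (bond₁ bond₂ bond₃ bond₄ plaqDatum plaqKappa
  linkAffine_reTr_plaqHol)

namespace Literature.MathematicalPhysics.QuantumFieldTheory.Balaban1983to89.T3NontrivialityFromTilt

/-! ## §1 Affine level sets on `SU(2)` are Haar-null -/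

section SU2Geometry

/-- The cone `{x | ⟪d, x⟫ = s‖x‖}` over an affine slice (latitude sphere) of the unit sphere of a Euclidean space of dimension `≥ 2` is
null for additive Haar measure when `d ≠ 0`: the hyperplane `dᗮ` for `s = 0`, T4RadialProjectionAC's degenerate cone of `−s⁻¹d` for `s ≠ 0` —
the cone reading of «a sphere of positive codimension in `S³` has uniform measure zero». [cite: Chatterjee2026YMHiggs, §3.2 (Haar on SU(2) = uniform measure on S³)] -/
theorem addHaar_innerCone_eq_zero {E : Type*} [NormedAddCommGroup E] [InnerProductSpace ℝ E] [FiniteDimensional ℝ E] [MeasurableSpace E]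
    [BorelSpace E] (μ : Measure E) [μ.IsAddHaarMeasure] (h2 : 2 ≤ Module.finrank ℝ E) {d : E} (hd : d ≠ 0) (s : ℝ) :
    μ {x : E | ⟪d, x⟫ = s * ‖x‖} = 0 := by
  by_cases hs : s = 0
  · have hsub : {x : E | ⟪d, x⟫ = s * ‖x‖} ⊆ (((ℝ ∙ d)ᗮ : Submodule ℝ E) : Set E) := by
      intro x hx
      rw [mem_setOf_eq, hs, zero_mul] at hx
      rw [SetLike.mem_coe, Submodule.mem_orthogonal_singleton_iff_inner_right]
      exact hx
    refine measure_mono_null hsub (Measure.addHaar_submodule _ _ ?_)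
    intro htop
    have hmem : d ∈ ((ℝ ∙ d)ᗮ : Submodule ℝ E) := by
      rw [htop]
      trivial
    rw [Submodule.mem_orthogonal_singleton_iff_inner_right] at hmem
    exact hd (inner_self_eq_zero.1 hmem)
  · have hsub : {x : E | ⟪d, x⟫ = s * ‖x‖} ⊆ T4RadialProjectionAC.degenerateCone ((-s⁻¹) • d) := by
      intro x hx
      rw [mem_setOf_eq] at hx
      rw [T4RadialProjectionAC.mem_degenerateCone, real_inner_smul_left, hx, ← mul_assoc, neg_mul, inv_mul_cancel₀ hs]
      ring
    exact measure_mono_null hsub (T4RadialProjectionAC.measure_degenerateCone _ _ h2)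

/-- The real part of a quaternion product as an inner product: `Re(x · a) = ⟪star a, x⟫`. [folklore] -/
private theorem re_mul_eq_inner (x a : ℍ) : (x * a).re = ⟪star a, x⟫ := by
  rw [real_inner_comm, Quaternion.inner_def, star_star]

/-- **AFFINE LEVEL SETS ON `SU(2)` ARE HAAR-NULL**: for `a ≠ 0` and all `κ t`, `Haar{g | κ + Re(su2Quat g · a) = t} = 0` — under
`SU(2) ≅ S³` (Haar = uniform measure) the set is a latitude sphere of `S³`, or empty. [cite: Chatterjee2026YMHiggs, §3.2 (Haar on SU(2) = uniform measure on S³)] -/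
theorem haar_affineLevel_eq_zero (κ : ℝ) {a : ℍ} (ha : a ≠ 0) (t : ℝ) :
    (HaarData.haar : Measure SU2) {g : SU2 | κ + (su2Quat g * a).re = t} = 0 := by
  letI : MeasurableSpace ℍ := Literature.Analysis.FluidPDE.Tao2016.quatMeasurableSpace
  haveI : BorelSpace ℍ := Literature.Analysis.FluidPDE.Tao2016.quatBorelSpace
  have hsa : star a ≠ 0 := star_ne_zero.mpr ha
  have hN : MeasurableSet {g : SU2 | κ + (su2Quat g * a).re = t} :=
    measurableSet_eq_fun ((Quaternion.continuous_re.comp (continuous_su2Quat.mul continuous_const)).measurable.const_add κ)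
      measurable_const
  rw [haarData_haar_eq, haar_null_iff hN]
  refine measure_mono_null (fun x hx => ?_)
    (measure_union_null (measure_singleton (0 : ℍ)) (addHaar_innerCone_eq_zero volume two_le_finrank_quaternion hsa (t - κ)))
  by_cases hx0 : x = 0
  · exact Or.inl hx0
  refine Or.inr ?_
  rw [mem_preimage, mem_setOf_eq, su2Quat_quatToSU2 hx0, smul_mul_assoc, Quaternion.re_smul, smul_eq_mul, re_mul_eq_inner] at hx
  rw [mem_setOf_eq]
  have hn : 0 < ‖x‖ := norm_pos_iff.2 hx0
  have key : ‖x‖ * (κ + ‖x‖⁻¹ * ⟪star a, x⟫) = ‖x‖ * t := by rw [hx]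
  rw [mul_add, ← mul_assoc, mul_inv_cancel₀ hn.ne', one_mul] at key
  linarith

end SU2Geometry

/-! ## §2 One-link affine observables have product-Haar-null level sets; the unit laws have no atoms along plaquette variables -/

section ProductHaar

variable {P : Params} {j : ℕ}

/-- **PRODUCT-HAAR NULLITY OF LEVEL SETS**: if a measurable function of the gauge field is one-link quaternion-affine with NON-ZERO datum
through some bond `b` at every base field (`LinkAffine f u b κ a`, `a ≠ 0`), then every level set `{u | f u = t}` is null for product Haar
measure — the lattice gauge measure is PRODUCT Haar over the links, so Fubini over the link `b` and §1 on each fibre.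
[cite: Chatterjee2026YMHiggs, §3.2 (product Haar measure; Haar on SU(2) = uniform measure on S³)] -/
theorem fieldMeasure_level_eq_zero_of_linkAffine [DecidableEq (PBond P j)] {f : GaugeField P j SU2 → ℝ} (hf : Measurable f)
    (b : PBond P j) (h : ∀ u : GaugeField P j SU2, ∃ (κ : ℝ) (a : ℍ), a ≠ 0 ∧ LinkAffine f u b κ a) (t : ℝ) :
    fieldMeasure P j SU2 {u | f u = t} = 0 := by
  haveI : IsProbabilityMeasure (HaarData.haar : Measure SU2) := HaarData.isProb
  -- work on the product type `PBond P j → SU2` (= `GaugeField P j SU2` by definition)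
  set S : Set (PBond P j → SU2) := {u | f u = t} with hS_def
  change Measure.pi (fun _ : PBond P j => (HaarData.haar : Measure SU2)) S = 0
  have hS : MeasurableSet S := hf (measurableSet_singleton t)
  have hind : Measurable (S.indicator (1 : (PBond P j → SU2) → ℝ≥0∞)) := measurable_one.indicator hS
  have key : (∫⋯∫⁻_{b}, S.indicator 1 ∂fun _ : PBond P j => (HaarData.haar : Measure SU2)) =
      ∫⋯∫⁻_{b}, (fun _ => 0) ∂fun _ : PBond P j => (HaarData.haar : Measure SU2) := by
    rw [lmarginal_singleton, lmarginal_singleton]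
    funext u
    obtain ⟨κ, a, ha, hLA⟩ := h u
    have hN : MeasurableSet {g : SU2 | κ + (su2Quat g * a).re = t} :=
      measurableSet_eq_fun ((Quaternion.continuous_re.comp (continuous_su2Quat.mul continuous_const)).measurable.const_add κ)
        measurable_const
    have hfun : (fun g : SU2 => S.indicator (1 : (PBond P j → SU2) → ℝ≥0∞) (Function.update u b g)) =
        {g : SU2 | κ + (su2Quat g * a).re = t}.indicator 1 := by
      funext g
      have hiff : Function.update u b g ∈ S ↔ g ∈ {g : SU2 | κ + (su2Quat g * a).re = t} := by
        change f (Function.update u b g) = t ↔ κ + (su2Quat g * a).re = t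
        rw [hLA g]
      by_cases hg : g ∈ {g : SU2 | κ + (su2Quat g * a).re = t}
      · rw [indicator_of_mem (hiff.mpr hg), indicator_of_mem hg]
        rfl
      · rw [indicator_of_notMem (fun hm => hg (hiff.mp hm)), indicator_of_notMem hg]
    simp only [lintegral_zero]
    rw [hfun, lintegral_indicator_one hN, haar_affineLevel_eq_zero κ ha t]
  have hint := lintegral_eq_of_lmarginal_eq (μ := fun _ : PBond P j => (HaarData.haar : Measure SU2)) {b} hind measurable_const key
  rwa [lintegral_indicator_one hS, lintegral_zero] at hint

/-- **EVERY PLAQUETTE VARIABLE `reTr U(∂p)` HAS PRODUCT-HAAR-NULL LEVEL SETS** (`SU(2)`, every torus, every level): it is one-link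
affine through its first letter with the unit-quaternion staple datum (`linkAffine_reTr_plaqHol`); in particular the plaquette variable
has a continuous law under product Haar measure. [cite: Chatterjee2026YMHiggs, §3.2 (product Haar measure; Haar on SU(2) = uniform measure on S³)] -/
theorem fieldMeasure_plaqLevel_eq_zero (p : Plaq P j) (t : ℝ) :
    fieldMeasure P j SU2 {u | GaugeGroup.reTr (GaugeField.plaqHol u p) = t} = 0 := by
  classical
  refine fieldMeasure_level_eq_zero_of_linkAffine (RegularGaugeGroup.measurable_reTr.comp (Missing.measurable_plaqHol p))
    (bond₁ p) (fun u => ⟨plaqKappa u (bond₁ p) p, plaqDatum u (bond₁ p) p, ?_, linkAffine_reTr_plaqHol u (bond₁ p) p⟩) t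
  rw [plaqDatum, if_pos rfl]
  exact su2Quat_ne_zero _

end ProductHaar

/-! ## §3 The plaquette label of the unit torus: dictionary, and NO ATOMS under any unit law (`SU(2)`, printed averaging) -/

section Plaquette

variable {P : Params} {j : ℕ} {G : Type*} [GaugeGroup G]

/-- Torus bookkeeping: `((x + e_μ) + e_ν) − e_μ = x + e_ν`. [folklore] -/
private theorem shift_shift_unshift (x : Site P j) (μ ν : Fin P.d) : ((x.shift μ).shift ν).unshift μ = x.shift ν := by
  funext κ
  simp only [Site.shift, Site.unshift, Function.update_apply]
  by_cases hκμ : κ = μ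
  · subst hκμ
    by_cases hκν : κ = ν
    · subst hκν; simp
    · simp [hκν]
  · by_cases hκν : κ = ν
    · subst hκν; simp [hκμ]
    · simp [hκμ, hκν]

/-- Torus bookkeeping: `(x + e_ν) − e_ν = x`. [folklore] -/
private theorem shift_unshift' (x : Site P j) (ν : Fin P.d) : (x.shift ν).unshift ν = x := by
  funext κ
  simp only [Site.shift, Site.unshift, Function.update_apply]
  by_cases hκν : κ = ν
  · subst hκν; simp
  · simp [hκν]

variable {F : T3Family}

/-- **THE PLAQUETTE LABEL READS THE PLAQUETTE VARIABLE**: for `μ < ν` the unit-lattice loop variable of `plaquette3 x μ ν` is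
`reTr U(∂p)`, `p = ⟨x; μ < ν⟩` (`Setup`'s `GaugeField.plaqHol`). [cite: Balaban1987RG1, (0.2) p.252] -/
theorem loopAt_plaquette3 (x : F.USite) {μ ν : Fin 3} (hμν : μ < ν) (u : GaugeField (F.P 0) 0 G) :
    loopAt u ((plaquette3 x μ ν).1.atLevel 0) = GaugeGroup.reTr (GaugeField.plaqHol u ⟨F.toLevel 0 x, μ, ν, hμν⟩) := by
  simp only [loopAt, plaquette3, UWord3.atLevel, plaqWord, walk, holAt_cons, holAt_nil, mul_one, if_true,
    GaugeField.plaqHol, shift_shift_unshift, shift_unshift', mul_assoc]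
  simp

/-- The reversed orientation `μ > ν` reads the SAME number: `reTr (U(∂p)⁻¹) = reTr U(∂p)`, `p = ⟨x; ν < μ⟩`. [cite: Balaban1987RG1, (0.2) p.252] -/
theorem loopAt_plaquette3_rev (x : F.USite) {μ ν : Fin 3} (hνμ : ν < μ) (u : GaugeField (F.P 0) 0 G) :
    loopAt u ((plaquette3 x μ ν).1.atLevel 0) = GaugeGroup.reTr (GaugeField.plaqHol u ⟨F.toLevel 0 x, ν, μ, hνμ⟩) := by
  rw [← GaugeGroup.reTr_inv]
  simp only [loopAt, plaquette3, UWord3.atLevel, plaqWord, walk, holAt_cons, holAt_nil, mul_one, if_true,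
    GaugeField.plaqHol, shift_shift_unshift, shift_unshift', mul_assoc, mul_inv_rev, inv_inv]
  simp

/-- **NO ATOMS**: under EVERY unit law `unitLaw K` of the d = 3 scheme at the printed averaging (`SU(2)`, `γ ≥ 0`), the loop variable of a
non-degenerate plaquette label takes each value with probability `0` — the unit law has a density w.r.t. product Haar on `T₁`
(`T3UnitLawDensityEML.unitLaw_eq_withDensity_emlDensity`) and plaquette level sets are product-Haar-null (§2). [cite: Balaban1985UV3, (2) p.256 + (6) p.257] -/
theorem unitLaw_plaquetteLevel_eq_zero (F : T3Family) {γ : ℝ} (hγ : 0 ≤ γ) (K : ℕ) (x : F.USite) {μ ν : Fin 3} (hμν : μ ≠ ν) (t : ℝ) :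
    F.unitLaw ℰp measurableE_ℰp γ K {u | loopAt u ((plaquette3 x μ ν).1.atLevel 0) = t} = 0 := by
  rw [T3UnitLawDensityEML.unitLaw_eq_withDensity_emlDensity F K hγ]
  refine withDensity_absolutelyContinuous _ _ ?_
  rcases lt_or_gt_of_ne hμν with h | h
  · simp_rw [loopAt_plaquette3 x h]
    exact fieldMeasure_plaqLevel_eq_zero _ t
  · simp_rw [loopAt_plaquette3_rev x h]
    exact fieldMeasure_plaqLevel_eq_zero _ t

end Plaquette

/-! ## §4 THE CORE: under `UnitTiltTail` with summable rates, an atomless unit-scale observable has variance bounded below for all large `K` -/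

section Core

variable {F : T3Family} {G : Type*} [GaugeGroup G] [MeasurableSpace G] [HaarData G] [RegularGaugeGroup G]
  {ℰ : LoopAverage G} {γ : ℝ} {r w w' : ℕ → ℝ}

omit [RegularGaugeGroup G] in
/-- The radii and masses of `UnitTiltTail` are non-negative (radius is part of `IsTilt`; masses dominate measures). [cite: King1986, Thm 3.4 (3.9) p.656] -/
theorem nonneg_of_unitTiltTail (h : UnitTiltTail F ℰ γ r w w') : (∀ K, 0 ≤ r K) ∧ (∀ K, 0 ≤ w K) ∧ ∀ K, 0 ≤ w' K := by
  obtain ⟨Gd₀, Gd₁, -, -, htilt, htail⟩ := h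
  exact ⟨fun K => (htilt K).nonneg, fun K => measureReal_nonneg.trans (htail K).1, fun K => measureReal_nonneg.trans (htail K).2⟩

/-- `3/4 ≤ e^{−1/4}`. [folklore] -/
private theorem three_quarters_le_exp : (3 : ℝ) / 4 ≤ Real.exp (-(1 / 4)) := by
  have h := Real.add_one_le_exp (-(1 / 4 : ℝ))
  linarith

/-- Single-point continuity: a finite measure without an atom of `W` at `m` gives mass `≤ 1/4` to a small window around `m`. [folklore] -/
private theorem exists_window_le_quarter {X : Type*} [MeasurableSpace X] (ν : Measure X) [IsFiniteMeasure ν] {W : X → ℝ} (hWm : Measurable W)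
    (m : ℝ) (h0 : ν {u | W u = m} = 0) : ∃ δ : ℝ, 0 < δ ∧ ν.real {u | |W u - m| < δ} ≤ 1 / 4 := by
  set s : ℕ → Set X := fun n => {u | |W u - m| < 1 / ((n : ℝ) + 1)} with hs_def
  have hmeas : ∀ n, NullMeasurableSet (s n) ν := fun n =>
    (measurableSet_lt ((hWm.sub measurable_const).abs) measurable_const).nullMeasurableSet
  have hanti : Antitone s := by
    intro a b hab u hu
    simp only [hs_def, mem_setOf_eq] at hu ⊢
    have hab' : (a : ℝ) + 1 ≤ (b : ℝ) + 1 := by exact_mod_cast Nat.succ_le_succ hab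
    exact hu.trans_le (one_div_le_one_div_of_le (by positivity) hab')
  have hI : (⋂ n, s n) = {u | W u = m} := by
    ext u
    simp only [mem_iInter, hs_def, mem_setOf_eq]
    constructor
    · intro hu
      by_contra hne
      have hpos : 0 < |W u - m| := abs_pos.mpr (sub_ne_zero.mpr hne)
      obtain ⟨n, hn⟩ := exists_nat_one_div_lt hpos
      exact (lt_irrefl _) ((hu n).trans hn)
    · intro hu n
      rw [hu, sub_self, abs_zero]
      positivity
  have hlim := tendsto_measure_iInter_atTop hmeas hanti ⟨0, measure_ne_top _ _⟩
  rw [hI, h0] at hlim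
  have hev : ∀ᶠ n in atTop, ν (s n) < ENNReal.ofReal (1 / 4) :=
    hlim.eventually (gt_mem_nhds (by simp))
  obtain ⟨n, hn⟩ := hev.exists
  refine ⟨1 / ((n : ℝ) + 1), by positivity, ?_⟩
  exact ENNReal.toReal_le_of_le_ofReal (by norm_num) hn.le

/-- **THE CORE THEOREM.**  `UnitTiltTail F ℰ γ r w w'` with `r, w, w'` SUMMABLE (no smallness), a measurable unit-field observable `|W| ≤ 1`
which has NO ATOMS under any unit law: then for some `c > 0` and all large `K`, `Var_K(W) = ∫W² dμ_K − (∫W dμ_K)² ≥ c`.  Proof: gen 6's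
multiplicative lower transfer from a LATE cut-off `K₀` (tails of the three series small), the limit `m` of the means (King's Cauchy device),
a window `{|W − m| < δ}` of `μ_{K₀}`-mass `≤ 1/4` (no atom at `m`), and Chebyshev. [cite: King1986, Thm 3.4 (3.9)-(3.13) pp.656-657] -/
theorem variance_eventually_ge_of_unitTiltTail (hE : ℰ.MeasurableE) (hγ : 0 ≤ γ) (h : UnitTiltTail F ℰ γ r w w')
    (hr : Summable r) (hw : Summable w) (hw' : Summable w')
    {W : GaugeField (F.P 0) 0 G → ℝ} (hWm : Measurable W) (hW1 : ∀ u, |W u| ≤ 1)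
    (hat : ∀ (K : ℕ) (a : ℝ), F.unitLaw ℰ hE γ K {u | W u = a} = 0) :
    ∃ c : ℝ, 0 < c ∧ ∀ᶠ K in atTop, c ≤ (∫ u, W u ^ 2 ∂F.unitLaw ℰ hE γ K) - (∫ u, W u ∂F.unitLaw ℰ hE γ K) ^ 2 := by
  obtain ⟨hr0, hw0, hw0'⟩ := nonneg_of_unitTiltTail h
  -- Step 1: a late cut-off `K₀`: tails of the three summable series below `1/8`
  have hR : Tendsto (fun K₀ : ℕ => ∑' i, r (K₀ + i)) atTop (𝓝 0) :=
    (tendsto_sum_nat_add r).congr fun K₀ => tsum_congr fun i => by rw [add_comm]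
  have hT : Tendsto (fun K₀ : ℕ => ∑' i, (w (K₀ + i) + w' (K₀ + i))) atTop (𝓝 0) :=
    (tendsto_sum_nat_add fun k => w k + w' k).congr fun K₀ => tsum_congr fun i => by rw [add_comm i K₀]
  obtain ⟨K₀, hK₀R, hK₀T⟩ : ∃ K₀ : ℕ, ∑' i, r (K₀ + i) < 1 / 8 ∧ ∑' i, (w (K₀ + i) + w' (K₀ + i)) < 1 / 8 :=
    ((hR.eventually (gt_mem_nhds (by norm_num))).and (hT.eventually (gt_mem_nhds (by norm_num)))).exists
  -- Step 2: the limit of the means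
  obtain ⟨m, hm⟩ := exists_tendsto_integral_unitLaw hE hγ hr hw hw' h hWm hW1
  -- Step 3: no atom at `m` under `μ_{K₀}`: a window of mass ≤ 1/4
  haveI hP : ∀ K, IsProbabilityMeasure (F.unitLaw ℰ hE γ K) := fun K => isProbabilityMeasure_unitLaw hE hγ K
  obtain ⟨δ, hδ, hwin⟩ := exists_window_le_quarter (F.unitLaw ℰ hE γ K₀) hWm m (hat K₀ m)
  -- Step 4: the means settle within `δ/2` of `m`
  obtain ⟨K₁, hK₁⟩ := Metric.tendsto_atTop.1 hm (δ / 2) (half_pos hδ)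
  -- the far event and its indicator
  set A : Set (GaugeField (F.P 0) 0 G) := {u | δ ≤ |W u - m|} with hA_def
  have hA : MeasurableSet A := measurableSet_le measurable_const ((hWm.sub measurable_const).abs)
  set V : GaugeField (F.P 0) 0 G → ℝ := A.indicator 1 with hV_def
  have hVm : Measurable V := measurable_one.indicator hA
  have hV0 : ∀ u, 0 ≤ V u := fun u => by
    by_cases hu : u ∈ A
    · rw [hV_def, indicator_of_mem hu]; norm_num
    · rw [hV_def, indicator_of_notMem hu]
  have hV1 : ∀ u, V u ≤ 1 := fun u => by
    by_cases hu : u ∈ A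
    · rw [hV_def, indicator_of_mem hu]; norm_num
    · rw [hV_def, indicator_of_notMem hu]; norm_num
  -- `μ_{K₀}(A) ≥ 3/4`
  have hA₀ : (3 : ℝ) / 4 ≤ ∫ u, V u ∂F.unitLaw ℰ hE γ K₀ := by
    rw [hV_def, integral_indicator_one hA]
    have hcompl : Aᶜ = {u | |W u - m| < δ} := by
      ext u
      simp only [hA_def, mem_compl_iff, mem_setOf_eq, not_le]
    have hsum : (F.unitLaw ℰ hE γ K₀).real A + (F.unitLaw ℰ hE γ K₀).real Aᶜ = 1 := by
      rw [measureReal_add_measureReal_compl hA, probReal_univ]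
    rw [hcompl] at hsum
    linarith
  -- Step 5: assembly for `K ≥ max K₀ K₁`
  refine ⟨7 * δ ^ 2 / 64, by positivity, eventually_atTop.2 ⟨max K₀ K₁, fun K hK => ?_⟩⟩
  have hKK₀ : K₀ ≤ K := (le_max_left _ _).trans hK
  have hKK₁ : K₁ ≤ K := (le_max_right _ _).trans hK
  set μK := F.unitLaw ℰ hE γ K with hμK_def
  set mK : ℝ := ∫ u, W u ∂μK with hmK_def
  have hmK : |mK - m| < δ / 2 := by
    have := hK₁ K hKK₁
    rwa [Real.dist_eq] at this
  -- the lower transfer of the far event from `K₀` to `K`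
  have htr := le_integral_unitLaw_mul hE hγ h hr hw hw' hr0 hw0 hw0' hVm hV0 hV1 K₀ K hKK₀
  have hexp : (3 : ℝ) / 4 ≤ Real.exp (-2 * ∑' i, r (K₀ + i)) :=
    three_quarters_le_exp.trans (Real.exp_le_exp.2 (by linarith))
  have hprod : (3 : ℝ) / 4 * (3 / 4) ≤ Real.exp (-2 * ∑' i, r (K₀ + i)) * ∫ u, V u ∂F.unitLaw ℰ hE γ K₀ :=
    mul_le_mul hexp hA₀ (by norm_num) (Real.exp_pos _).le
  have hVK : (7 : ℝ) / 16 ≤ ∫ u, V u ∂μK := by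
    rw [hμK_def]
    linarith
  -- integrability bookkeeping
  have hbdd : ∀ {f : GaugeField (F.P 0) 0 G → ℝ} (B : ℝ), Measurable f → (∀ u, |f u| ≤ B) → Integrable f μK := fun B hf hB =>
    (integrable_const B).mono' hf.aestronglyMeasurable (ae_of_all _ fun u => by rw [Real.norm_eq_abs]; exact hB u)
  have hWi : Integrable W μK := hbdd 1 hWm hW1
  have hW2i : Integrable (fun u => W u ^ 2) μK := hbdd 1 (hWm.pow_const 2) fun u => by
    rw [abs_pow, ← one_pow 2]
    exact pow_le_pow_left₀ (abs_nonneg _) (hW1 u) 2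
  have hVi : Integrable V μK := hbdd 1 hVm fun u => by rw [abs_of_nonneg (hV0 u)]; exact hV1 u
  -- the variance as a centred second moment
  have hI1 : Integrable (fun u => 2 * mK * W u) μK := hWi.const_mul _
  have hI2 : Integrable (fun u => W u ^ 2 - 2 * mK * W u) μK := hW2i.sub hI1
  have hexpand : (fun u => (W u - mK) ^ 2) = fun u => (W u ^ 2 - 2 * mK * W u) + mK ^ 2 := by
    funext u; ring
  have hI3 : Integrable (fun u => (W u - mK) ^ 2) μK := by
    rw [hexpand]; exact hI2.add (integrable_const _)
  have hvar : (∫ u, W u ^ 2 ∂μK) - mK ^ 2 = ∫ u, (W u - mK) ^ 2 ∂μK := by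
    rw [hexpand, integral_add hI2 (integrable_const _), integral_sub hW2i hI1, integral_const_mul, integral_const,
      probReal_univ, one_smul]
    ring
  -- Chebyshev on the far event, pointwise
  have hpt : ∀ u, (δ / 2) ^ 2 * V u ≤ (W u - mK) ^ 2 := fun u => by
    by_cases hu : u ∈ A
    · rw [hV_def, indicator_of_mem hu, Pi.one_apply, mul_one]
      have hfar : δ ≤ |W u - m| := hu
      have htri : |W u - m| - |mK - m| ≤ |W u - mK| := by
        have := abs_sub_abs_le_abs_sub (W u - m) (mK - m)
        rwa [show W u - m - (mK - m) = W u - mK by ring] at this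
      have hge : δ / 2 ≤ |W u - mK| := by linarith
      calc (δ / 2) ^ 2 ≤ |W u - mK| ^ 2 := pow_le_pow_left₀ (by positivity) hge 2
        _ = (W u - mK) ^ 2 := sq_abs _
    · rw [hV_def, indicator_of_notMem hu, mul_zero]
      positivity
  have hcheb : (δ / 2) ^ 2 * ∫ u, V u ∂μK ≤ ∫ u, (W u - mK) ^ 2 ∂μK := by
    rw [← integral_const_mul]
    exact integral_mono (hVi.const_mul _) hI3 hpt
  rw [hvar]
  calc 7 * δ ^ 2 / 64 = (δ / 2) ^ 2 * (7 / 16) := by ring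
    _ ≤ (δ / 2) ^ 2 * ∫ u, V u ∂μK := mul_le_mul_of_nonneg_left hVK (by positivity)
    _ ≤ ∫ u, (W u - mK) ^ 2 ∂μK := hcheb

end Core

/-! ## §5 (NT3) for the plaquette labels, and the node's non-triviality conjunct, from `UnitTiltTail` ALONE (`SU(2)`, printed averaging) -/

section NT3

variable {F : T3Family} {γ : ℝ} {r w w' : ℕ → ℝ}

/-- **(NT3) FROM THE UNIT-SCALE TILT, NO SMALLNESS**: `UnitTiltTail F ℰp γ r w w'` with `r, w, w'` summable (`γ ≥ 0`, printed averaging on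
`SU(2)`) gives `UniformVariance (F.scheme ℰp γ) (plaquette3 x μ ν) c` for some `c > 0`, for EVERY base point and every pair of distinct
directions — the variance of the unit-scale block-averaged plaquette variable does NOT vanish as `ε → 0`. [cite: Chatterjee2019YMProbabilists, §6 p.19] -/
theorem exists_uniformVariance_plaquette_of_unitTiltTail (F : T3Family) (hγ : 0 ≤ γ) (h : UnitTiltTail F ℰp γ r w w')
    (hr : Summable r) (hw : Summable w) (hw' : Summable w') (x : F.USite) {μ ν : Fin 3} (hμν : μ ≠ ν) :
    ∃ c : ℝ, UniformVariance (F.scheme ℰp γ) (plaquette3 x μ ν) c := by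
  obtain ⟨c, hc, hev⟩ := variance_eventually_ge_of_unitTiltTail measurableE_ℰp hγ h hr hw hw'
    (measurable_loopAt ((plaquette3 x μ ν).1.atLevel 0)) (fun u => abs_loopAt_le_one u _)
    (fun K a => unitLaw_plaquetteLevel_eq_zero F hγ K x hμν a)
  refine ⟨c, hc, ?_⟩
  filter_upwards [hev] with K hK
  rw [expectAt_eq_integral_unitLaw measurableE_ℰp hγ K, expectAt_eq_integral_unitLaw measurableE_ℰp hγ K]
  simpa [pow_two] using hK

/-- Hence **`LimitPointsNontrivial (F.scheme ℰp γ)` from `UnitTiltTail` alone** (summable rates; every torus family `F`, `γ ≥ 0`).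
[cite: JaffeWittenClay2006, §4 p.6] -/
theorem limitPointsNontrivial_of_unitTiltTail_summable (F : T3Family) (hγ : 0 ≤ γ) (h : UnitTiltTail F ℰp γ r w w')
    (hr : Summable r) (hw : Summable w) (hw' : Summable w') : LimitPointsNontrivial (F.scheme ℰp γ) := by
  obtain ⟨c, hc⟩ := exists_uniformVariance_plaquette_of_unitTiltTail F hγ h hr hw hw' (0 : F.USite)
    (show (0 : Fin 3) ≠ 1 by decide)
  exact limitPointsNontrivial_of_uniformVariance hc

/-- **THE RUNG'S TARGET PLUS NON-TRIVIALITY FROM K1 ∧ K2 ALONE**: `UnitTiltTail F ℰp γ r w w'` with summable rates gives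
`ContinuumYM3Torus F ℰp γ ∧ LimitPointsNontrivial (F.scheme ℰp γ)` — existence (King's Cauchy device), uniqueness/RP/covariance (node theorems)
and now non-triviality, with no further hypothesis. [cite: JaffeWittenClay2006, §6.5 p.11] -/
theorem continuumYM3Torus_nontrivial_of_unitTiltTail (F : T3Family) (hγ : 0 ≤ γ) (h : UnitTiltTail F ℰp γ r w w')
    (hr : Summable r) (hw : Summable w) (hw' : Summable w') :
    ContinuumYM3Torus F ℰp γ ∧ LimitPointsNontrivial (F.scheme ℰp γ) :=
  ⟨continuumYM3Torus_of_unitTiltTail F ℰp measurableE_ℰp hγ hr hw hw' h,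
    limitPointsNontrivial_of_unitTiltTail_summable F hγ h hr hw hw'⟩

/-- **THE NON-GAUSSIAN LIMIT LOOP LAW FROM K1 ∧ K2 ALONE**: under `UnitTiltTail F ℰp γ r w w'` with summable rates the loop laws converge
weakly along the full sequence to a law `ν` on `[-1,1]^{ULoop3 F}` carrying all limits of joint expectations, whose plaquette marginal has
variance `≥ c > 0` and is NOT Gaussian. [cite: JaffeWittenClay2006, §4 p.6] -/
theorem limitLoopLaw_plaquette_nondegenerate (F : T3Family) (hγ : 0 ≤ γ) (h : UnitTiltTail F ℰp γ r w w')
    (hr : Summable r) (hw : Summable w) (hw' : Summable w') (x : F.USite) {μ ν : Fin 3} (hμν : μ ≠ ν) :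
    ∃ (c : ℝ) (νL : ProbabilityMeasure (T4LimitLaw.Cube (ULoop3 F))), 0 < c ∧
      Tendsto (loopLaw F (F.avgMeasurable_of_measurableE ℰp measurableE_ℰp) hγ) atTop (𝓝 νL) ∧
      (∀ Cs : List (ULoop3 F), Tendsto (fun K => (F.scheme ℰp γ).expectAt K Cs) atTop
        (𝓝 (∫ y, T4LimitLaw.monomial Cs y ∂(νL : Measure (T4LimitLaw.Cube (ULoop3 F)))))) ∧
      c ≤ ProbabilityTheory.variance (fun y => ((y (plaquette3 x μ ν) : Set.Icc (-1 : ℝ) 1) : ℝ))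
        (νL : Measure (T4LimitLaw.Cube (ULoop3 F))) ∧
      ∀ (a : ℝ) (v : NNReal), (νL : Measure (T4LimitLaw.Cube (ULoop3 F))).map
        (fun y => ((y (plaquette3 x μ ν) : Set.Icc (-1 : ℝ) 1) : ℝ)) ≠ ProbabilityTheory.gaussianReal a v := by
  obtain ⟨c, hc⟩ := exists_uniformVariance_plaquette_of_unitTiltTail F hγ h hr hw hw' x hμν
  obtain ⟨νL, h1, h2, h3, h4⟩ := limitLoopLaw_nondegenerate F measurableE_ℰp hγ
    (hasContinuumLimit_of_unitTiltTail measurableE_ℰp hγ hr hw hw' h) hc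
  exact ⟨c, νL, hc.1, h1, h2, h3, h4⟩

end NT3

end Literature.MathematicalPhysics.QuantumFieldTheory.Balaban1983to89.T3NontrivialityFromTilt

end
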